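import Literature.Analysis.FluidPDE.SelfSimilarCollapseAnsatz
import Literature.Analysis.FluidPDE.CurlFreeLiouville
import Literature.Analysis.FluidPDE.PoincareHomotopyOperator
import HarnessLib

/-!
# Viscous rigidity from VELOCITY covariance alone (arbitrary pressure): the vorticity is harmonic

Summit `NavierStokesRegularity`, cell topic directory `FluidComputer`, namespace
`…FluidComputer.SelfSimilarCensus` (kernel side of the `ns-blowup` cell's self-similar census
`selfsim/SELFSIM-NOGO.md`, row (M16-V)); companion to `DssScalingViscousRigidity.lean` (which
assumed the pressure to be covariant as well). PROVED theorems only; no data, no named facts.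

## The observation

Let `q ∈ (0,1)`, `γ ≠ ½`, `ν ≠ 0`, and suppose ONLY the velocity is `(γ, q)`-scaling covariant on a
parabolic neighbourhood `{T−δ < t < T} × B(0, r)`, `u(T − q(T−t), q^γ x) = q^{γ−1} u(t, x)`, while
`(u, p)` solves the Navier–Stokes momentum equation there with SOME pressure `p` (`C²` slices). As
in the companion file, `∂ₜu` and `(u·∇)u` transform with the weight `q^{γ−2}` and `Δu` with
`q^{−1−γ}`; subtracting the two momentum equations now leaves the pressures:

  `ν (q^{−1−γ} − q^{γ−2}) Δu(t, x) = ∇p(t′)(q^γ x) − q^{γ−2} ∇p(t)(x) = ∇_x[ q^{−γ} p(t′, q^γ x) − q^{γ−2} p(t, x) ]`.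

So `Δu(t, ·)` IS A GRADIENT on the ball; hence `curl Δu(t, ·) = 0` (`curl ∘ ∇ = 0`), and since
`curl Δ = Δ curl` for `C³` fields (tree `curl_laplacian`), **the vorticity `ω = curl u(t, ·)` is
harmonic on the neighbourhood** (`laplacian_curl_eq_zero_of_velocity_covariant`). Globally (covariance
and the equation on all of `ℝ³`, `div u = 0`, bounded velocity and bounded vorticity slices):
Liouville makes `ω(t, ·)` constant, the field `u(t, ·) − ½ ω₀ × y` is then curl- and divergence-free,
hence harmonic (tree `laplacian_eq_zero_of_curl_eq_zero_of_isDivFree`), so `u(t, ·)` is a bounded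
harmonic field: CONSTANT (`velocity_eq_const_of_velocity_covariant`). No pressure ansatz, no
symmetry class, no energy hypothesis; incompressibility enters only in the last step.

This closes the pressure caveat (M16-R) of the census: the velocity-only ansatz (M1) of
`SELFSIM-NOGO.md` with `c_l ≠ ½` and ANY smooth pressure is rigid.

## WHAT THIS IS NOT

Not a statement about `γ = ½` (λ-DSS / Leray; untouched), not about asymptotically self-similar
blow-up, not a regularity theorem (the step "constant near the singular point ⇒ regular point"
belongs to the solution class).

## Tree / Mathlib tools

`curl_laplacian`, `contDiff_curl`, `curl_sub` (`VorticityCalculus.lean`); `curlCLM_crossCLM`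
(`PoincareHomotopyOperator.lean`); `laplacian_eq_zero_of_curl_eq_zero_of_isDivFree`,
`trace_eq_sum_coord` (`CurlFreeLiouville.lean`, `VorticityStretching.lean`);
`curl_gradient_eq_zero_holds`, `gradient_comp_smul`, `laplacian_const_smul_comp_smul`,
`fderiv_const_smul_comp_smul'`; Mathlib `laplacian_congr_nhds`, `Filter.EventuallyEq.fderiv_eq`,
`HasDerivAt.scomp`, `ContDiffAt.laplacian_add`, `InnerProductSpace.HarmonicOnNhd.apply_eq_apply_of_abs_le`.

## References

* J. Leray, Acta Math. 63 (1934), (3.11)–(3.12). [Leray1934]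
* J. Nečas, M. Růžička, V. Šverák, Acta Math. 176 (1996), Introduction. [NecasRuzickaSverak1996]
* A. J. Majda, A. L. Bertozzi, *Vorticity and Incompressible Flow* (CUP 2002), §1.2 (solid-body
  rotation `½ ω × h` has vorticity `ω`), §2.4 (`curl ∇ = 0`). [MajdaBertozziCUP2002]
-/

noncomputable section

open Set Filter Topology InnerProductSpace Metric
open scoped Laplacian RealInnerProductSpace

namespace Summit.NavierStokesRegularity.FluidComputer.SelfSimilarCensus

open Literature.Analysis.FluidPDE

section VelocityCovariance

variable {γ T ν δ r q : ℝ}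
  {u : ℝ → EuclideanSpace ℝ (Fin 3) → EuclideanSpace ℝ (Fin 3)}
  {p : ℝ → EuclideanSpace ℝ (Fin 3) → ℝ}

/-- **Velocity covariance makes `Δu` a gradient.** Let `q ∈ (0,1)`, `γ > 0`, `γ ≠ ½`, `ν ≠ 0`.
Suppose the velocity alone is `(γ, q)`-covariant on `{T−δ < t < T} × B(0, r)`,
`u(T − q(T−t), q^γ x) = q^{γ−1} u(t, x)`; each `t ↦ u(t, x)` is differentiable on `(T−δ, T)`; the
pressure slices `p(t, ·)` are `C²`; and `∂ₜu + (u·∇)u + ∇p − νΔu = 0` holds pointwise there. Then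
for `t ∈ (T−δ, T)` and `x ∈ B(0, r)`:
`Δu(t, x) = ∇Ψ(x)` with `Ψ(z) = (ν(q^{−1−γ} − q^{γ−2}))⁻¹ (q^{−γ} p(t′, q^γ z) − q^{γ−2} p(t, z))`,
`t′ = T − q(T−t)`. [folklore] -/
theorem laplacian_eq_gradient_of_velocity_covariant (hq0 : 0 < q) (hq1 : q < 1) (hγ0 : 0 < γ)
    (hγ : γ ≠ 1 / 2) (hν : ν ≠ 0)
    (hut : ∀ t ∈ Ioo (T - δ) T, ∀ x, DifferentiableAt ℝ (fun s => u s x) t)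
    (hp : ∀ t ∈ Ioo (T - δ) T, ContDiff ℝ 2 (p t))
    (hcov : ∀ t ∈ Ioo (T - δ) T, ∀ x ∈ ball (0 : EuclideanSpace ℝ (Fin 3)) r,
      u (T - q * (T - t)) (q ^ γ • x) = q ^ (γ - 1) • u t x)
    (hNS : ∀ t ∈ Ioo (T - δ) T, ∀ x ∈ ball (0 : EuclideanSpace ℝ (Fin 3)) r,
      timeDeriv u t x + convect (u t) (u t) x + gradient (p t) x - ν • (Δ (u t)) x = 0)
    {t : ℝ} (ht : t ∈ Ioo (T - δ) T) {x : EuclideanSpace ℝ (Fin 3)}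
    (hx : x ∈ ball (0 : EuclideanSpace ℝ (Fin 3)) r) :
    (Δ (u t)) x = gradient (fun z => (ν * (q ^ (-1 - γ) - q ^ (γ - 2)))⁻¹ *
        (q ^ (-γ) * p (T - q * (T - t)) (q ^ γ • z) - q ^ (γ - 2) * p t z)) x := by
  -- the image point
  set t' : ℝ := T - q * (T - t) with ht'def
  set x' : EuclideanSpace ℝ (Fin 3) := q ^ γ • x with hx'def
  have ht' : t' ∈ Ioo (T - δ) T := by
    obtain ⟨h1, h2⟩ := ht
    have hTt : 0 < T - t := by linarith
    exact ⟨by nlinarith [mul_lt_mul_of_pos_right hq1 hTt], by nlinarith [mul_pos hq0 hTt]⟩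
  have hx' : x' ∈ ball (0 : EuclideanSpace ℝ (Fin 3)) r := by
    rw [mem_ball_zero_iff] at hx ⊢
    rw [hx'def, norm_smul, Real.norm_of_nonneg (Real.rpow_nonneg hq0.le γ)]
    have h1 : q ^ γ ≤ 1 := Real.rpow_le_one hq0.le hq1.le hγ0.le
    calc q ^ γ * ‖x‖ ≤ 1 * ‖x‖ := mul_le_mul_of_nonneg_right h1 (norm_nonneg _)
      _ < r := by rw [one_mul]; exact hx
  have hqnγ : q ^ (-γ) ≠ 0 := (Real.rpow_pos_of_pos hq0 (-γ)).ne'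
  have hback : q ^ (-γ) • x' = x := by
    rw [hx'def, smul_smul, ← Real.rpow_add hq0, neg_add_cancel, Real.rpow_zero, one_smul]
  -- (N1) spatial covariance of u near x'
  have hball : ball (0 : EuclideanSpace ℝ (Fin 3)) (q ^ γ * r) ∈ 𝓝 x' := by
    apply isOpen_ball.mem_nhds
    rw [mem_ball_zero_iff] at hx ⊢
    rw [hx'def, norm_smul, Real.norm_of_nonneg (Real.rpow_nonneg hq0.le γ)]
    exact mul_lt_mul_of_pos_left hx (Real.rpow_pos_of_pos hq0 γ)
  have hpre : ∀ z ∈ ball (0 : EuclideanSpace ℝ (Fin 3)) (q ^ γ * r),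
      q ^ (-γ) • z ∈ ball (0 : EuclideanSpace ℝ (Fin 3)) r := by
    intro z hz
    rw [mem_ball_zero_iff] at hz ⊢
    rw [norm_smul, Real.norm_of_nonneg (Real.rpow_nonneg hq0.le _)]
    have hq' : q ^ (-γ) * (q ^ γ * r) = r := by
      rw [← mul_assoc, ← Real.rpow_add hq0, neg_add_cancel, Real.rpow_zero, one_mul]
    calc q ^ (-γ) * ‖z‖ < q ^ (-γ) * (q ^ γ * r) :=
          mul_lt_mul_of_pos_left hz (Real.rpow_pos_of_pos hq0 _)
      _ = r := hq'
  have hsm : ∀ z : EuclideanSpace ℝ (Fin 3), q ^ γ • (q ^ (-γ) • z) = z := fun z => by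
    rw [smul_smul, ← Real.rpow_add hq0, add_neg_cancel, Real.rpow_zero, one_smul]
  have N1 : u t' =ᶠ[𝓝 x'] fun z => q ^ (γ - 1) • u t (q ^ (-γ) • z) := by
    filter_upwards [hball] with z hz
    have h := hcov t ht (q ^ (-γ) • z) (hpre z hz)
    rw [hsm z] at h
    exact h
  -- (N3) temporal covariance near t'
  have hIoo : Ioo (T - q * δ) T ∈ 𝓝 t' := by
    apply Ioo_mem_nhds
    · rw [ht'def]; nlinarith [ht.1, mul_pos hq0 (show 0 < T - t by linarith [ht.2])]
    · exact ht'.2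
  have N3 : (fun s => u s x') =ᶠ[𝓝 t'] fun s => q ^ (γ - 1) • u (T - (T - s) / q) x := by
    filter_upwards [hIoo] with s hs
    have hσ : T - (T - s) / q ∈ Ioo (T - δ) T := by
      obtain ⟨hs1, hs2⟩ := hs
      constructor
      · have : (T - s) / q < δ := by rw [div_lt_iff₀ hq0]; linarith
        linarith
      · have : 0 < (T - s) / q := div_pos (by linarith) hq0
        linarith
    have h := hcov (T - (T - s) / q) hσ x hx
    have e : T - q * (T - (T - (T - s) / q)) = s := by field_simp; ring
    rw [e] at h
    exact h
  -- derivative identities at (t', x')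
  have hΔ : (Δ (u t')) x' = q ^ (-1 - γ) • (Δ (u t)) x := by
    rw [(laplacian_congr_nhds N1).eq_of_nhds, laplacian_const_smul_comp_smul _ _ hqnγ, hback,
      show q ^ (γ - 1) * (q ^ (-γ)) ^ 2 = q ^ (-1 - γ) by
        rw [sq, ← Real.rpow_add hq0, ← Real.rpow_add hq0]; congr 1; ring]
  have hD : fderiv ℝ (u t') x' = (q ^ (γ - 1) * q ^ (-γ)) • fderiv ℝ (u t) x := by
    rw [N1.fderiv_eq, fderiv_const_smul_comp_smul', hback]
  have hval : u t' x' = q ^ (γ - 1) • u t x := hcov t ht x hx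
  have hconv : convect (u t') (u t') x' = q ^ (γ - 2) • convect (u t) (u t) x := by
    rw [convect, convect, hD, hval]
    change (q ^ (γ - 1) * q ^ (-γ)) • (fderiv ℝ (u t) x) (q ^ (γ - 1) • u t x) = _
    rw [map_smul, smul_smul,
      show q ^ (γ - 1) * q ^ (-γ) * q ^ (γ - 1) = q ^ (γ - 2) by
        rw [← Real.rpow_add hq0, ← Real.rpow_add hq0]; congr 1; ring]
  have htime : timeDeriv u t' x' = q ^ (γ - 2) • timeDeriv u t x := by
    rw [timeDeriv, timeDeriv, N3.deriv_eq]
    have hσt : T - (T - t') / q = t := by rw [ht'def]; field_simp; ring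
    have hg : HasDerivAt (fun τ => u τ x) (deriv (fun τ => u τ x) t) (T - (T - t') / q) := by
      rw [hσt]; exact (hut t ht x).hasDerivAt
    have hσ : HasDerivAt (fun s : ℝ => T - (T - s) / q) (q⁻¹) t' :=
      ((((hasDerivAt_id t').const_sub T).div_const q).const_sub T).congr_deriv
        (by rw [neg_div, neg_neg, one_div])
    have hcomp : HasDerivAt (fun s => q ^ (γ - 1) • u (T - (T - s) / q) x)
        (q ^ (γ - 1) • q⁻¹ • deriv (fun τ => u τ x) t) t' :=
      (hg.scomp t' hσ).const_smul (q ^ (γ - 1))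
    rw [hcomp.deriv, smul_smul,
      show q ^ (γ - 1) * q⁻¹ = q ^ (γ - 2) by
        rw [← Real.rpow_neg_one, ← Real.rpow_add hq0]; congr 1; ring]
  -- the pressure gradient at x' as a gradient in the x variable
  have hgradscale : gradient (fun z => p t' (q ^ γ • z)) x = q ^ γ • gradient (p t') x' :=
    gradient_comp_smul (p t') (q ^ γ) x
  -- compare the two equations
  have E1 := hNS t ht x hx
  have E2 := hNS t' ht' x' hx'
  rw [htime, hconv, hΔ] at E2
  have hw : q ^ (γ - 2) ≠ q ^ (-1 - γ) := by
    rcases lt_or_gt_of_ne hγ with h | h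
    · exact (Real.rpow_lt_rpow_of_exponent_gt hq0 hq1 (by linarith : γ - 2 < -1 - γ)).ne'
    · exact (Real.rpow_lt_rpow_of_exponent_gt hq0 hq1 (by linarith : -1 - γ < γ - 2)).ne
  have hc : ν * (q ^ (-1 - γ) - q ^ (γ - 2)) ≠ 0 := mul_ne_zero hν (sub_ne_zero.mpr hw.symm)
  -- key identity: ν (q^{-1-γ} - q^{γ-2}) Δu = ∇p(t')(x') - q^{γ-2} ∇p(t)(x)
  have key : (ν * (q ^ (-1 - γ) - q ^ (γ - 2))) • (Δ (u t)) x =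
      gradient (p t') x' - q ^ (γ - 2) • gradient (p t) x := by
    have h3 : (ν * (q ^ (-1 - γ) - q ^ (γ - 2))) • (Δ (u t)) x -
        (gradient (p t') x' - q ^ (γ - 2) • gradient (p t) x) =
        q ^ (γ - 2) • (timeDeriv u t x + convect (u t) (u t) x + gradient (p t) x -
          ν • (Δ (u t)) x) -
        (q ^ (γ - 2) • timeDeriv u t x + q ^ (γ - 2) • convect (u t) (u t) x + gradient (p t') x' -
          ν • q ^ (-1 - γ) • (Δ (u t)) x) := by
      module
    rw [E1, E2, smul_zero, sub_zero] at h3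
    exact sub_eq_zero.mp h3
  -- rewrite the right-hand side as a gradient in x and divide by the constant
  have hdiffF : DifferentiableAt ℝ (fun z => p t' (q ^ γ • z)) x :=
    ((hp t' ht').differentiable (by norm_num)).differentiableAt.comp x
      ((differentiableAt_id).const_smul (q ^ γ))
  have hdiffG : DifferentiableAt ℝ (p t) x := ((hp t ht).differentiable (by norm_num)) x
  have hF : HasFDerivAt (fun z => p t' (q ^ γ • z)) (fderiv ℝ (fun z => p t' (q ^ γ • z)) x) x :=
    hdiffF.hasFDerivAt
  have hG : HasFDerivAt (p t) (fderiv ℝ (p t) x) x := hdiffG.hasFDerivAt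
  have hH : HasFDerivAt
      (fun z => (ν * (q ^ (-1 - γ) - q ^ (γ - 2)))⁻¹ *
        (q ^ (-γ) * p t' (q ^ γ • z) - q ^ (γ - 2) * p t z))
      ((ν * (q ^ (-1 - γ) - q ^ (γ - 2)))⁻¹ •
        (q ^ (-γ) • fderiv ℝ (fun z => p t' (q ^ γ • z)) x - q ^ (γ - 2) • fderiv ℝ (p t) x)) x :=
    ((hF.const_mul (q ^ (-γ))).sub (hG.const_mul (q ^ (γ - 2)))).const_mul
      (ν * (q ^ (-1 - γ) - q ^ (γ - 2)))⁻¹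
  simp only [gradient] at key hgradscale ⊢
  rw [hH.fderiv]
  simp only [map_smul, map_sub]
  rw [hgradscale, smul_smul (q ^ (-γ)) (q ^ γ), ← Real.rpow_add hq0, neg_add_cancel, Real.rpow_zero,
    one_smul, ← key, smul_smul, inv_mul_cancel₀ hc, one_smul]

/-- `curl` depends only on the germ: if `f = g` near `x` then `curl f x = curl g x`. [folklore] -/
theorem curl_congr_of_eventuallyEq {f g : EuclideanSpace ℝ (Fin 3) → EuclideanSpace ℝ (Fin 3)}
    {x : EuclideanSpace ℝ (Fin 3)} (h : f =ᶠ[𝓝 x] g) : curl f x = curl g x := by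
  rw [curl_eq_curlCLM, curl_eq_curlCLM, h.fderiv_eq]

/-- **Velocity covariance ⇒ `curl Δu = 0` and the VORTICITY IS HARMONIC.** Under the hypotheses of
`laplacian_eq_gradient_of_velocity_covariant` and with `C³` velocity slices: for `t ∈ (T−δ, T)`
and `x ∈ B(0, r)`, `curl (Δ u(t,·)) (x) = 0` and `Δ (curl u(t,·)) (x) = 0` (`curl ∘ ∇ = 0`, then
`curl Δ = Δ curl`). No pressure ansatz. [folklore] -/
theorem laplacian_curl_eq_zero_of_velocity_covariant (hq0 : 0 < q) (hq1 : q < 1) (hγ0 : 0 < γ)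
    (hγ : γ ≠ 1 / 2) (hν : ν ≠ 0)
    (hu : ∀ t ∈ Ioo (T - δ) T, ContDiff ℝ 3 (u t))
    (hut : ∀ t ∈ Ioo (T - δ) T, ∀ x, DifferentiableAt ℝ (fun s => u s x) t)
    (hp : ∀ t ∈ Ioo (T - δ) T, ContDiff ℝ 2 (p t))
    (hcov : ∀ t ∈ Ioo (T - δ) T, ∀ x ∈ ball (0 : EuclideanSpace ℝ (Fin 3)) r,
      u (T - q * (T - t)) (q ^ γ • x) = q ^ (γ - 1) • u t x)
    (hNS : ∀ t ∈ Ioo (T - δ) T, ∀ x ∈ ball (0 : EuclideanSpace ℝ (Fin 3)) r,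
      timeDeriv u t x + convect (u t) (u t) x + gradient (p t) x - ν • (Δ (u t)) x = 0)
    {t : ℝ} (ht : t ∈ Ioo (T - δ) T) {x : EuclideanSpace ℝ (Fin 3)}
    (hx : x ∈ ball (0 : EuclideanSpace ℝ (Fin 3)) r) :
    curl (Δ (u t)) x = 0 ∧ (Δ (curl (u t))) x = 0 := by
  set c : ℝ := (ν * (q ^ (-1 - γ) - q ^ (γ - 2)))⁻¹ with hc
  set Ψ : EuclideanSpace ℝ (Fin 3) → ℝ := fun z =>
    c * (q ^ (-γ) * p (T - q * (T - t)) (q ^ γ • z) - q ^ (γ - 2) * p t z) with hΨ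
  -- Δu = ∇Ψ on the open ball, hence near x
  have hloc : Δ (u t) =ᶠ[𝓝 x] gradient Ψ := by
    filter_upwards [isOpen_ball.mem_nhds hx] with z hz
    exact laplacian_eq_gradient_of_velocity_covariant (T := T) (p := p) hq0 hq1 hγ0 hγ hν hut hp
      hcov hNS ht hz
  -- Ψ is C²
  have ht' : T - q * (T - t) ∈ Ioo (T - δ) T := by
    obtain ⟨h1, h2⟩ := ht
    have hTt : 0 < T - t := by linarith
    exact ⟨by nlinarith [mul_lt_mul_of_pos_right hq1 hTt], by nlinarith [mul_pos hq0 hTt]⟩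
  have hΨ2 : ContDiff ℝ 2 Ψ := by
    have h1 : ContDiff ℝ 2 fun z : EuclideanSpace ℝ (Fin 3) => p (T - q * (T - t)) (q ^ γ • z) :=
      (hp _ ht').comp (contDiff_id.const_smul (q ^ γ))
    exact contDiff_const.mul ((contDiff_const.mul h1).sub (contDiff_const.mul (hp t ht)))
  have hcurl : curl (Δ (u t)) x = 0 := by
    rw [curl_congr_of_eventuallyEq hloc]
    exact curl_gradient_eq_zero_holds Ψ hΨ2 x
  exact ⟨hcurl, by rw [← curl_laplacian (hu t ht) x]; exact hcurl⟩

/-! ### Global version: Liouville endgame -/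

/-- A `C²` vector field on `ℝ³` with vanishing Laplacian and a uniform bound is constant
(Liouville per coordinate; tree `InnerProductSpace.HarmonicOnNhd.apply_eq_apply_of_abs_le`). [folklore] -/
theorem field_eq_const_of_laplacian_eq_zero_of_bounded
    {V : EuclideanSpace ℝ (Fin 3) → EuclideanSpace ℝ (Fin 3)} (hV : ContDiff ℝ 2 V)
    (hΔ : ∀ y, (Δ V) y = 0) {M : ℝ} (hM : ∀ y, ‖V y‖ ≤ M) (x y : EuclideanSpace ℝ (Fin 3)) :
    V x = V y := by
  have hharm : HarmonicOnNhd V univ := harmonicOnNhd_of_laplacian_eq_zero hV hΔ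
  apply ext_inner_left ℝ
  intro a
  have hcomp : HarmonicOnNhd (⇑(innerSL ℝ a) ∘ V) univ := hharm.comp_CLM (innerSL ℝ a)
  have hbdd : ∀ z, |(⇑(innerSL ℝ a) ∘ V) z| ≤ ‖a‖ * M := fun z => by
    rw [Function.comp_apply, innerSL_apply_apply ℝ]
    exact (abs_real_inner_le_norm a (V z)).trans (mul_le_mul_of_nonneg_left (hM z) (norm_nonneg a))
  have := hcomp.apply_eq_apply_of_abs_le hbdd x y
  simpa [Function.comp_apply, innerSL_apply_apply ℝ] using this

/-- **Constant vorticity.** If the velocity covariance (`q ∈ (0,1)`, `γ > 0`, `γ ≠ ½`) and the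
Navier–Stokes momentum equation with `ν ≠ 0` and SOME `C²` pressure hold on all of `ℝ³` for
`t ∈ (T−δ, T)`, the velocity slices are `C³` with differentiable time lines, and the vorticity
slices are bounded, then the vorticity is constant in space: `curl u(t,·)(x) = curl u(t,·)(0)`.
[folklore] -/
theorem curl_eq_const_of_velocity_covariant (hq0 : 0 < q) (hq1 : q < 1) (hγ0 : 0 < γ)
    (hγ : γ ≠ 1 / 2) (hν : ν ≠ 0)
    (hu : ∀ t ∈ Ioo (T - δ) T, ContDiff ℝ 3 (u t))
    (hut : ∀ t ∈ Ioo (T - δ) T, ∀ x, DifferentiableAt ℝ (fun s => u s x) t)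
    (hp : ∀ t ∈ Ioo (T - δ) T, ContDiff ℝ 2 (p t))
    (hcov : ∀ t ∈ Ioo (T - δ) T, ∀ x, u (T - q * (T - t)) (q ^ γ • x) = q ^ (γ - 1) • u t x)
    (hNS : ∀ t ∈ Ioo (T - δ) T, ∀ x,
      timeDeriv u t x + convect (u t) (u t) x + gradient (p t) x - ν • (Δ (u t)) x = 0)
    {Mω : ℝ → ℝ} (hMω : ∀ t ∈ Ioo (T - δ) T, ∀ x, ‖curl (u t) x‖ ≤ Mω t)
    {t : ℝ} (ht : t ∈ Ioo (T - δ) T) (x : EuclideanSpace ℝ (Fin 3)) :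
    curl (u t) x = curl (u t) 0 := by
  have hΔω : ∀ y, (Δ (curl (u t))) y = 0 := fun y =>
    (laplacian_curl_eq_zero_of_velocity_covariant (T := T) (p := p) (r := ‖y‖ + 1) hq0 hq1 hγ0 hγ
      hν hu hut hp (fun s hs z _ => hcov s hs z) (fun s hs z _ => hNS s hs z) ht
      (by rw [mem_ball_zero_iff]; linarith)).2
  have hω2 : ContDiff ℝ 2 (curl (u t)) := contDiff_curl (n := 2) (by exact_mod_cast hu t ht)
  exact field_eq_const_of_laplacian_eq_zero_of_bounded hω2 hΔω (hMω t ht) x 0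

/-- The curl of the solid-body rotation field `y ↦ ½ ω₀ × y` is `ω₀` (Majda–Bertozzi §1.2). [folklore] -/
theorem curl_half_cross (ω₀ y : EuclideanSpace ℝ (Fin 3)) :
    curl (⇑((1 / 2 : ℝ) • crossCLM ω₀)) y = ω₀ := by
  rw [curl_eq_curlCLM, ContinuousLinearMap.fderiv, map_smul, curlCLM_crossCLM, smul_smul]
  norm_num

/-- The solid-body rotation field `y ↦ ½ ω₀ × y` is divergence free. [folklore] -/
theorem divergence_half_cross (ω₀ y : EuclideanSpace ℝ (Fin 3)) :
    VectorCalculus.divergence (⇑((1 / 2 : ℝ) • crossCLM ω₀)) y = 0 := by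
  rw [VectorCalculus.divergence, ContinuousLinearMap.fderiv, ContinuousLinearMap.toLinearMap_smul,
    map_smul, trace_eq_sum_coord]
  simp [crossCLM_apply, cross, cross_apply, Fin.sum_univ_three]

/-- The Laplacian of a continuous linear map vanishes. [folklore] -/
theorem laplacian_clm_eq_zero (L : EuclideanSpace ℝ (Fin 3) →L[ℝ] EuclideanSpace ℝ (Fin 3))
    (y : EuclideanSpace ℝ (Fin 3)) : (Δ (⇑L)) y = 0 := by
  rw [laplacian_eq_sum_fderiv_fderiv (EuclideanSpace.basisFun (Fin 3) ℝ) L.contDiff y]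
  simp [ContinuousLinearMap.fderiv]

/-- **Velocity-only covariance rigidity (global).** If the velocity covariance
(`q ∈ (0,1)`, `γ > 0`, `γ ≠ ½`) and the Navier–Stokes momentum equation with `ν ≠ 0` and SOME `C²`
pressure hold on all of `ℝ³` for `t ∈ (T−δ, T)`, the velocity slices are `C³`, divergence free,
bounded, with bounded vorticity and differentiable time lines, then every velocity slice is
CONSTANT: `u(t, x) = u(t, 0)`. (Constant vorticity `ω₀`; `u(t,·) − ½ ω₀ × y` is curl- and
divergence-free hence harmonic; so `u(t,·)` is a bounded harmonic field.) No pressure ansatz, no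
symmetry class, no energy hypothesis. [folklore] -/
theorem velocity_eq_const_of_velocity_covariant (hq0 : 0 < q) (hq1 : q < 1) (hγ0 : 0 < γ)
    (hγ : γ ≠ 1 / 2) (hν : ν ≠ 0)
    (hu : ∀ t ∈ Ioo (T - δ) T, ContDiff ℝ 3 (u t))
    (hut : ∀ t ∈ Ioo (T - δ) T, ∀ x, DifferentiableAt ℝ (fun s => u s x) t)
    (hp : ∀ t ∈ Ioo (T - δ) T, ContDiff ℝ 2 (p t))
    (hdiv : ∀ t ∈ Ioo (T - δ) T, VectorCalculus.IsDivFree (u t))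
    (hcov : ∀ t ∈ Ioo (T - δ) T, ∀ x, u (T - q * (T - t)) (q ^ γ • x) = q ^ (γ - 1) • u t x)
    (hNS : ∀ t ∈ Ioo (T - δ) T, ∀ x,
      timeDeriv u t x + convect (u t) (u t) x + gradient (p t) x - ν • (Δ (u t)) x = 0)
    {M : ℝ → ℝ} (hM : ∀ t ∈ Ioo (T - δ) T, ∀ x, ‖u t x‖ ≤ M t)
    {Mω : ℝ → ℝ} (hMω : ∀ t ∈ Ioo (T - δ) T, ∀ x, ‖curl (u t) x‖ ≤ Mω t)
    {t : ℝ} (ht : t ∈ Ioo (T - δ) T) (x : EuclideanSpace ℝ (Fin 3)) : u t x = u t 0 := by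
  -- constant vorticity
  set ω₀ : EuclideanSpace ℝ (Fin 3) := curl (u t) 0 with hω₀
  have hω : ∀ y, curl (u t) y = ω₀ := fun y =>
    curl_eq_const_of_velocity_covariant (T := T) (p := p) hq0 hq1 hγ0 hγ hν hu hut hp hcov hNS
      hMω ht y
  -- subtract the solid-body rotation
  set L : EuclideanSpace ℝ (Fin 3) →L[ℝ] EuclideanSpace ℝ (Fin 3) := (1 / 2 : ℝ) • crossCLM ω₀
    with hL
  have hu2 : ContDiff ℝ 2 (u t) := (hu t ht).of_le (by norm_num)
  have hW2 : ContDiff ℝ 2 (u t - ⇑L) := hu2.sub L.contDiff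
  have hudiff : ∀ y, DifferentiableAt ℝ (u t) y := fun y =>
    (hu2.differentiable (by norm_num)) y
  have hcurlW : ∀ y, curl (u t - ⇑L) y = 0 := fun y => by
    show curl (fun z => u t z - L z) y = 0
    rw [curl_sub (hudiff y) (L.differentiableAt), hω y, hL, curl_half_cross, sub_self]
  have hdivW : VectorCalculus.IsDivFree (u t - ⇑L) := fun y => by
    have h1 := hdiv t ht y
    have h2 := divergence_half_cross ω₀ y
    rw [VectorCalculus.divergence] at h1 h2 ⊢
    rw [← hL] at h2
    rw [fderiv_sub (hudiff y) L.differentiableAt, ContinuousLinearMap.toLinearMap_sub, map_sub, h1,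
      h2, sub_zero]
  have hΔW : ∀ y, (Δ (u t - ⇑L)) y = 0 :=
    laplacian_eq_zero_of_curl_eq_zero_of_isDivFree hW2 hcurlW hdivW
  -- hence u(t,·) is harmonic
  have hΔu : ∀ y, (Δ (u t)) y = 0 := fun y => by
    have e : u t = (u t - ⇑L) + ⇑L := by funext z; simp
    rw [e, (hW2.contDiffAt).laplacian_add (L.contDiff.contDiffAt), hΔW y, laplacian_clm_eq_zero L y,
      add_zero]
  exact field_eq_const_of_laplacian_eq_zero_of_bounded hu2 hΔu (hM t ht) x 0

end VelocityCovariance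

end Summit.NavierStokesRegularity.FluidComputer.SelfSimilarCensus

end
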